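import Literature.Analysis.UnboundedOperators.FourierSpectrumSupportProofs
import Literature.Analysis.UnboundedOperators.TranslationGroupSmearing
import Literature.Analysis.Distribution.FourierSupportAtZero
import Literature.Analysis.FunctionSpaces.SchwartzDistributionSupport
import Mathlib.Analysis.InnerProductSpace.Projection.Submodule
import HarnessLib

/-!
# The cluster theorem for unitary representations of translation groups

Topic `Literature/Analysis/UnboundedOperators`, proofs layer over `UnitaryRep` / `FourierSpectrum`
(items C4/C5: strongly continuous unitary representations, the SNAG-free spectral condition
`UnitaryRep.HasFourierSpectrumIn`, vacua `HasUniqueVacuum`) and over the smeared vectors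
`∫ k(a) • U(a) ψ da` of `TranslationGroupSmearing` (Streater–Wightman §2-6, (2-113)–(2-114)).
This file proves the Hilbert-space core of the **cluster decomposition property** of quantum
field theory (Streater–Wightman, *PCT, Spin and Statistics, and All That* (1964), §3-4, Thm. 3-4;
in the general form without a mass gap due to Araki–Hepp–Ruelle, Helv. Phys. Acta 35 (1962) 164),
for a strongly continuous unitary representation `U` of the translation group of a
finite-dimensional real inner product space `P` on a complex Hilbert space `H`:

`UnitaryRep.tendsto_inner_apply_of_eqOn` — if `U` has Fourier spectrum in a closed set `C` with
`C ∩ (−C) ⊆ {0}` (the closed forward light cone in the application) and a unique vacuum `Ω`,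
`‖Ω‖ = 1`, and two matrix coefficients are *exchanged* on a set `S`,
`⟪ψ₁, U(s) χ₁⟫ = ⟪ψ₂, U(−s) χ₂⟫` for `s ∈ S` (for fields: `⟪Ω, A B_s Ω⟫ = ⟪Ω, B_s A Ω⟫` at large
spacelike `s`, by locality) with `⟪ψ₁, Ω⟫⟪Ω, χ₁⟫ = ⟪ψ₂, Ω⟫⟪Ω, χ₂⟫`, then
`⟪ψ₁, U(x_t) χ₁⟫ → ⟪ψ₁, Ω⟫⟪Ω, χ₁⟫` along every path `x_t` with `x_t + z ∈ S` eventually for each `z`.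

SW prove Thm. 3-4 only under a mass gap (Ruelle's argument, pp. 111–113: the Fourier transforms
of the two orderings live in the forward/backward cones, locality equates them at large spacelike
separation, and a smooth multiplier `θ(P)` separating `{P² ≥ M², P⁰ > 0}` from `{P⁰ ≤ 0}` needs the
gap). Here the gap is replaced by the mean ergodic theorem at the unique vacuum; only convergence
(no rate) is obtained, which is what (3-37) asserts. The argument, SNAG-free throughout:

1. *Smeared vectors* `∫ k(a) • U(a) χ da` (SW §2-6 (2-113); with `k = 𝓕g` this is the spectral
   multiplier `g(P/2π)`): the matrix coefficients are `⟪φ, ∫ 𝓕g(a) U(a) χ da⟫ =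
   U.fourierMatrixCoeff φ χ g`, hence the smeared vector vanishes when `supp g` misses `(2π)⁻¹C`
   (spectral condition, SW (2-114)); translates and reflections give correlations
   (`inner_apply_integral_smul_apply`, `inner_apply_neg_integral_smul_apply_comp_neg`).
2. *Approximate identity*: with the plateaus `Θ_R` of `FourierSupportAtZero`,
   `∫ 𝓕Θ_R(a) U(a) η da → η` as `R → ∞` (`exists_norm_integral_fourier_plateau_sub_lt`).
3. *Weighted mean ergodic theorem*: for `χ ⊥ Ω`, `∫ 𝓕Θ_ε(a) U(a) χ da → 0` as `ε → 0⁺`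
   (`exists_norm_integral_fourier_plateau_lt`; von Neumann: on `U(y)ζ − ζ` the wide averages are
   `O(‖𝓕Θ₁(· − εy) − 𝓕Θ₁‖₁)`, these vectors span a dense subspace of `{Ω}ᗮ`, uniform bounds).
4. *Density* (`exists_integral_fourier_sub_lt`): `χ ⊥ Ω` is approximated by
   `∫ 𝓕g(a) U(a) χ da` with `supp g` off `−(2π)⁻¹C`: `Θ_R − Θ_ε` is supported in an annulus
   `⊆ (−C')ᶜ ∪ C'ᶜ` (`C' = (2π)⁻¹C`, `C' ∩ −C' ⊆ {0}`), and splits accordingly by a smooth partition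
   of unity (`exists_add_of_tsupport_subset_union`); the `C'ᶜ`-part smears `χ` to `0`.
5. *Cluster*: subtract the vacuum parts, `F₁ = ⟪ψ₁, U(·)χ₁'⟫`, `F₂ = ⟪ψ₂, U(−·)χ₂'⟫` agree on `S`;
   `⟪ψ₁, U(x) ∫ 𝓕g(a) U(a) χ₁' da⟫ = ∫ 𝓕g(a) F₁(x + a) da`, the partner correlation of `F₂`
   vanishes identically (reflected support, spectral condition), and
   `∫ 𝓕g(a)(F₁ − F₂)(x_t + a) da → 0` by dominated convergence.

## References

* R. F. Streater, A. S. Wightman, *PCT, Spin and Statistics, and All That* (1964; Princeton 2000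
  printing, PDF pp. 98–99 = book pp. 111–113), §3-4 Thm. 3-4 (cluster decomposition property,
  proved there under a mass gap), §2-6 eqs. (2-113)–(2-114) (smeared translations and the
  spectrum), §3-1 (spectral condition, uniqueness of the vacuum). [StreaterWightman1964]
* H. Araki, K. Hepp, D. Ruelle, *On the asymptotic behaviour of Wightman functions in space-like
  directions*, Helv. Phys. Acta 35 (1962) 164–174 (no mass gap). [ArakiHeppRuelle1962]
* M. Reed, B. Simon, *Methods of Modern Mathematical Physics I* (1980), Thm. II.11 (von Neumann's
  mean ergodic theorem), §VIII.4. [ReedSimonI1980]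
* L. Hörmander, *The Analysis of Linear Partial Differential Operators I*, Thm. 1.4.4 (partitions
  of unity). [HormanderALPDO1]

## Mathlib / tree

`integral_inner`, `ContinuousLinearMap.integral_comp_comm`, `integral_neg_eq_self`,
`MeasureTheory.Measure.integral_comp_smul_of_nonneg`, `tendsto_integral_filter_of_dominated_convergence`,
`Submodule.orthogonal_orthogonal_eq_closure`, `Submodule.span_induction`,
`SmoothPartitionOfUnity.exists_isSubordinate`, `squeeze_zero_norm'`; tree:
`UnitaryRep.integrable_smul_apply`, `norm_integral_smul_apply_le`, `inner_integral_smul_apply`,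
`apply_integral_smul_apply(')`, `integral_add/sub_smul_apply` (`TranslationGroupSmearing`),
`UnitaryRep.matrixCoeff`, `fourierMatrixCoeff`, `HasFourierSpectrumIn`,
`coe_fourier_fourier_eq_comp_neg` (`FourierSpectrum[SupportProofs]`), `plateauSchwartz`,
`fourier_plateauSchwartz_apply`, `integral_fourier_plateauSchwartz_one`,
`tendsto_integral_norm_translate_sub`, `integral_norm_scaled_translate_sub`, `integrable_fourier_mul`
(`FourierSupportAtZero`), `SchwartzSupport.exists_smooth_one_of_isCompact_subset_isOpen`
(`SchwartzDistributionSupport`). No SNAG theorem and no spectral measures are used; no definitions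
and no named facts are introduced (smeared vectors are written `∫ a, k a • U (ofAdd a) χ`, as in
`TranslationGroupSmearing`).
-/

noncomputable section

open MeasureTheory Filter Topology ComplexConjugate
open scoped InnerProductSpace FourierTransform SchwartzMap

namespace Literature.Analysis.UnboundedOperators

open Literature.Analysis.Distribution

variable {P : Type*} [NormedAddCommGroup P]
variable {H : Type*} [NormedAddCommGroup H] [InnerProductSpace ℂ H] [CompleteSpace H]

namespace UnitaryRep

/-! ### Group-theoretic preliminaries -/

section Group

variable (U : UnitaryRep (Multiplicative P) H)

/-- The orbit `a ↦ U(a) χ` of the translation group is continuous. [folklore] -/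
@[continuity, fun_prop]
theorem continuous_apply_ofAdd (χ : H) : Continuous fun a : P => U (Multiplicative.ofAdd a) χ :=
  (U.continuous_apply_apply χ).comp continuous_ofAdd

/-- The adjoint of `U(x)` is `U(−x)`: `⟪ψ, U(x) χ⟫ = ⟪U(−x) ψ, χ⟫`. [folklore] -/
theorem inner_apply_ofAdd_eq_inner_apply_neg (ψ χ : H) (x : P) :
    ⟪ψ, U (Multiplicative.ofAdd x) χ⟫_ℂ = ⟪U (Multiplicative.ofAdd (-x)) ψ, χ⟫_ℂ := by
  rw [← ContinuousLinearMap.adjoint_inner_left, U.adjoint_apply, ofAdd_neg]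

/-- Matrix coefficients are bounded: `‖⟪ψ, U(x) χ⟫‖ ≤ ‖ψ‖ ‖χ‖`. [folklore] -/
theorem norm_inner_apply_ofAdd_le (ψ χ : H) (x : P) :
    ‖⟪ψ, U (Multiplicative.ofAdd x) χ⟫_ℂ‖ ≤ ‖ψ‖ * ‖χ‖ :=
  U.norm_matrixCoeff_le ψ χ x

/-! ### Invariant vectors as the orthogonal complement of the vectors `U(y)ζ − ζ` -/

/-- A vector orthogonal to all `U(y)ζ − ζ` is invariant (`U(y)* w = w` for all `y`; von Neumann's
mean ergodic theorem, the identification of the orthogonal complement of the range of `U − 1`;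
Reed–Simon I, Thm. II.11). [cite: ReedSimonI1980, Thm II.11] -/
theorem orthogonal_span_apply_sub_le :
    (Submodule.span ℂ {v : H | ∃ (y : P) (ζ : H), v = U (Multiplicative.ofAdd y) ζ - ζ})ᗮ ≤
      U.invariantVectors := by
  intro w hw
  have key : ∀ y : P, U (Multiplicative.ofAdd (-y)) w = w := by
    intro y
    have h0 : ∀ ζ : H, ⟪ζ, U (Multiplicative.ofAdd (-y)) w - w⟫_ℂ = 0 := by
      intro ζ
      have h := Submodule.inner_right_of_mem_orthogonal
        (Submodule.subset_span (show U (Multiplicative.ofAdd y) ζ - ζ ∈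
          {v : H | ∃ (y : P) (ζ : H), v = U (Multiplicative.ofAdd y) ζ - ζ} from ⟨y, ζ, rfl⟩)) hw
      have h' : ⟪U (Multiplicative.ofAdd y) ζ, w⟫_ℂ = ⟪ζ, U (Multiplicative.ofAdd (-y)) w⟫_ℂ := by
        rw [U.inner_apply_ofAdd_eq_inner_apply_neg, neg_neg]
      rwa [inner_sub_left, h', ← inner_sub_right] at h
    have := h0 (U (Multiplicative.ofAdd (-y)) w - w)
    rwa [inner_self_eq_zero, sub_eq_zero] at this
  rw [mem_invariantVectors_iff]
  intro g
  have := key (-(Multiplicative.toAdd g))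
  simpa using this

/-- With a unique vacuum `Ω`, every vector orthogonal to `Ω` lies in the closed span of the
vectors `U(y)ζ − ζ` (Reed–Simon I, Thm. II.11: `H = ker(U − 1) ⊕ closure range(U − 1)`). [cite: ReedSimonI1980, Thm II.11] -/
theorem mem_closure_span_apply_sub {Ω : H} (hΩ : U.HasUniqueVacuum Ω) {χ : H}
    (hχ : ⟪Ω, χ⟫_ℂ = 0) :
    χ ∈ closure (Submodule.span ℂ
      {v : H | ∃ (y : P) (ζ : H), v = U (Multiplicative.ofAdd y) ζ - ζ} : Set H) := by
  have h1 : (ℂ ∙ Ω)ᗮ ≤ (Submodule.span ℂ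
      {v : H | ∃ (y : P) (ζ : H), v = U (Multiplicative.ofAdd y) ζ - ζ})ᗮᗮ := by
    refine Submodule.orthogonal_le ?_
    rw [← hΩ.2]
    exact U.orthogonal_span_apply_sub_le
  rw [Submodule.orthogonal_orthogonal_eq_closure] at h1
  have hmem : χ ∈ (ℂ ∙ Ω)ᗮ := (Submodule.mem_orthogonal_singleton_iff_inner_right).2 hχ
  exact h1 hmem

end Group

end UnitaryRep

variable [InnerProductSpace ℝ P] [FiniteDimensional ℝ P] [MeasurableSpace P] [BorelSpace P]

namespace UnitaryRep

variable (U : UnitaryRep (Multiplicative P) H)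

/-! ### Smeared vectors: complements to `TranslationGroupSmearing` -/

/-- Subtraction in the vector: `∫ k(a) U(a) (χ₁ − χ₂) da = ∫ k(a) U(a) χ₁ da − ∫ k(a) U(a) χ₂ da`. [folklore] -/
theorem integral_smul_apply_sub {k : P → ℂ} (hk : Integrable k) (χ₁ χ₂ : H) :
    ∫ a, k a • U (Multiplicative.ofAdd a) (χ₁ - χ₂) =
      (∫ a, k a • U (Multiplicative.ofAdd a) χ₁) - ∫ a, k a • U (Multiplicative.ofAdd a) χ₂ := by
  rw [← integral_sub (U.integrable_smul_apply hk χ₁) (U.integrable_smul_apply hk χ₂)]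
  simp_rw [map_sub, smul_sub]

/-- For a Schwartz kernel `𝓕g` the matrix coefficients of the smeared vector are the
Fourier-transformed matrix coefficients of `FourierSpectrum`:
`⟪φ, ∫ 𝓕g(a) U(a) χ da⟫ = U.fourierMatrixCoeff φ χ g` (`= ∫ g(p/2π) d⟪φ, E(p)χ⟫`,
Streater–Wightman (1964), §2-6, eq. (2-114)). [cite: StreaterWightman1964, §2-6 eq. (2-114)] -/
theorem inner_integral_fourier_smul_apply (g : 𝓢(P, ℂ)) (φ χ : H) :
    ⟪φ, ∫ a, (𝓕 g : 𝓢(P, ℂ)) a • U (Multiplicative.ofAdd a) χ⟫_ℂ = U.fourierMatrixCoeff φ χ g := by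
  rw [U.inner_integral_smul_apply (𝓕 g : 𝓢(P, ℂ)).integrable, fourierMatrixCoeff_apply]
  rfl

/-- If every Fourier-transformed matrix coefficient `g ↦ U.fourierMatrixCoeff φ χ g` of `χ` vanishes
on the test functions supported in `S`, then `∫ 𝓕g(a) U(a) χ da = 0` for `supp g ⊆ S`. [folklore] -/
theorem integral_fourier_smul_apply_eq_zero_of_isVanishingOn {S : Set P} {χ : H}
    (h : ∀ φ : H, Distribution.IsVanishingOn (U.fourierMatrixCoeff φ χ) S)
    {g : 𝓢(P, ℂ)} (hg : tsupport (g : P → ℂ) ⊆ S) :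
    ∫ a, (𝓕 g : 𝓢(P, ℂ)) a • U (Multiplicative.ofAdd a) χ = 0 := by
  refine ext_inner_left ℂ fun φ => ?_
  rw [inner_zero_right, inner_integral_fourier_smul_apply]
  exact h φ g hg

/-- **Spectral condition ⇒ vanishing of smeared vectors** ("`∫ da ρ(a) U(a, 1) = 0` for all
`ρ ∈ 𝒮` with `supp ρ̃` outside the energy–momentum spectrum", Streater–Wightman (1964), §2-6,
eq. (2-114)): if `U` has Fourier spectrum in `C` and `supp g` is disjoint from `(2π)⁻¹ C`, then
`∫ 𝓕g(a) U(a) χ da = 0`. [cite: StreaterWightman1964, §2-6 eq. (2-114)] -/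
theorem integral_fourier_smul_apply_eq_zero_of_hasFourierSpectrumIn {C : Set P}
    (hU : U.HasFourierSpectrumIn C) (χ : H) {g : 𝓢(P, ℂ)}
    (hg : tsupport (g : P → ℂ) ⊆ ((fun ξ : P => (2 * Real.pi) • ξ) ⁻¹' C)ᶜ) :
    ∫ a, (𝓕 g : 𝓢(P, ℂ)) a • U (Multiplicative.ofAdd a) χ = 0 :=
  U.integral_fourier_smul_apply_eq_zero_of_isVanishingOn (fun φ => hU φ χ) hg

/-- Smearing an invariant vector multiplies it by `∫ k`. [folklore] -/
theorem integral_smul_apply_of_mem_invariantVectors (k : P → ℂ) {Ω : H}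
    (hΩ : Ω ∈ U.invariantVectors) :
    ∫ a, k a • U (Multiplicative.ofAdd a) Ω = (∫ a, k a) • Ω := by
  rw [mem_invariantVectors_iff] at hΩ
  simp only [hΩ]
  exact integral_smul_const k Ω

/-- **Translates of smeared vectors**: `U(x) ∫ k(a) U(a) χ da = ∫ k(a) U(x + a) χ da`. [folklore] -/
theorem apply_ofAdd_integral_smul_apply {k : P → ℂ} (hk : Integrable k) (x : P) (χ : H) :
    U (Multiplicative.ofAdd x) (∫ a, k a • U (Multiplicative.ofAdd a) χ) =
      ∫ a, k a • U (Multiplicative.ofAdd (x + a)) χ := by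
  rw [← (U (Multiplicative.ofAdd x)).integral_comp_comm (U.integrable_smul_apply hk χ)]
  refine integral_congr_ae (Eventually.of_forall fun a => ?_)
  simp only [map_smul, apply_ofAdd_apply_ofAdd, add_comm a x]

/-- The integrand `k(a) • U(x + a) χ` is integrable. [folklore] -/
theorem integrable_smul_apply_ofAdd_add {k : P → ℂ} (hk : Integrable k) (x : P) (χ : H) :
    Integrable fun a : P => k a • U (Multiplicative.ofAdd (x + a)) χ := by
  refine (hk.norm.mul_const ‖χ‖).mono'
    (hk.aestronglyMeasurable.smul
      ((U.continuous_apply_ofAdd χ).comp (continuous_const.add continuous_id)).aestronglyMeasurable)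
    (Eventually.of_forall fun a => ?_)
  rw [norm_smul, U.norm_map]

/-- **Matrix coefficients of translates of smeared vectors are correlations**:
`⟪ψ, U(x) ∫ k(a) U(a) χ da⟫ = ∫ k(a) ⟪ψ, U(x + a) χ⟫ da`. [folklore] -/
theorem inner_apply_integral_smul_apply {k : P → ℂ} (hk : Integrable k) (ψ χ : H) (x : P) :
    ⟪ψ, U (Multiplicative.ofAdd x) (∫ a, k a • U (Multiplicative.ofAdd a) χ)⟫_ℂ =
      ∫ a, k a * U.matrixCoeff ψ χ (x + a) := by
  rw [U.apply_ofAdd_integral_smul_apply hk, ← integral_inner (U.integrable_smul_apply_ofAdd_add hk x χ)]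
  refine integral_congr_ae (Eventually.of_forall fun a => ?_)
  simp only [inner_smul_right, matrixCoeff_apply]

/-- Reflected kernels: `∫ k(a) U(−a) χ da = ∫ k(−b) U(b) χ db`. [folklore] -/
theorem integral_smul_apply_ofAdd_neg (k : P → ℂ) (χ : H) :
    ∫ a, k a • U (Multiplicative.ofAdd (-a)) χ = ∫ b, k (-b) • U (Multiplicative.ofAdd b) χ := by
  rw [← integral_neg_eq_self (fun b => k (-b) • U (Multiplicative.ofAdd b) χ)]
  simp only [neg_neg]

/-- Matrix coefficients of backward translates of the vector smeared with the reflected kernel: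
`⟪ψ, U(−x) ∫ k(−b) U(b) χ db⟫ = ∫ k(a) ⟪ψ, U(−(x + a)) χ⟫ da`. [folklore] -/
theorem inner_apply_neg_integral_smul_apply_comp_neg {k : P → ℂ} (hk : Integrable k) (ψ χ : H)
    (x : P) :
    ⟪ψ, U (Multiplicative.ofAdd (-x)) (∫ b, k (-b) • U (Multiplicative.ofAdd b) χ)⟫_ℂ =
      ∫ a, k a * U.matrixCoeff ψ χ (-(x + a)) := by
  have hk' : Integrable fun b : P => k (-b) := hk.comp_neg
  rw [U.inner_apply_integral_smul_apply hk',
    ← integral_neg_eq_self (fun a => k a * U.matrixCoeff ψ χ (-(x + a)))]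
  refine integral_congr_ae (Eventually.of_forall fun b => ?_)
  simp only [neg_add, neg_neg]

/-- **Smearing almost commutes with small translations**:
`‖∫ k(a) U(a) (U(y)ζ) da − ∫ k(a) U(a) ζ da‖ ≤ (∫ ‖k(a − y) − k(a)‖ da) ‖ζ‖`. [folklore] -/
theorem norm_integral_smul_apply_apply_sub_le {k : P → ℂ} (hk : Integrable k) (y : P) (ζ : H) :
    ‖(∫ a, k a • U (Multiplicative.ofAdd a) (U (Multiplicative.ofAdd y) ζ)) -
        ∫ a, k a • U (Multiplicative.ofAdd a) ζ‖ ≤ (∫ a, ‖k (a - y) - k a‖) * ‖ζ‖ := by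
  rw [← U.apply_integral_smul_apply' hk ζ y, U.apply_integral_smul_apply hk ζ y,
    ← U.integral_sub_smul_apply (hk.comp_sub_right y) hk]
  exact U.norm_integral_smul_apply_le _ ζ

/-! ### Schwartz kernels: sums, differences, reflections -/

/-- `𝓕(g₁ + g₂) = 𝓕g₁ + 𝓕g₂` as kernels. [folklore] -/
theorem coe_fourier_add (g₁ g₂ : 𝓢(P, ℂ)) :
    ((𝓕 (g₁ + g₂) : 𝓢(P, ℂ)) : P → ℂ) = (𝓕 g₁ : 𝓢(P, ℂ)) + (𝓕 g₂ : 𝓢(P, ℂ)) := by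
  have : (𝓕 (g₁ + g₂) : 𝓢(P, ℂ)) = 𝓕 g₁ + 𝓕 g₂ :=
    map_add (FourierTransform.fourierCLM ℂ (𝓢(P, ℂ))) g₁ g₂
  rw [this]
  rfl

/-- `𝓕(g₁ − g₂) = 𝓕g₁ − 𝓕g₂` as kernels. [folklore] -/
theorem coe_fourier_sub (g₁ g₂ : 𝓢(P, ℂ)) :
    ((𝓕 (g₁ - g₂) : 𝓢(P, ℂ)) : P → ℂ) = (𝓕 g₁ : 𝓢(P, ℂ)) - (𝓕 g₂ : 𝓢(P, ℂ)) := by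
  have : (𝓕 (g₁ - g₂) : 𝓢(P, ℂ)) = 𝓕 g₁ - 𝓕 g₂ :=
    map_sub (FourierTransform.fourierCLM ℂ (𝓢(P, ℂ))) g₁ g₂
  rw [this]
  rfl

/-- Smearing with `𝓕(g₁ + g₂)`. [folklore] -/
theorem integral_fourier_add_smul_apply (g₁ g₂ : 𝓢(P, ℂ)) (χ : H) :
    ∫ a, (𝓕 (g₁ + g₂) : 𝓢(P, ℂ)) a • U (Multiplicative.ofAdd a) χ =
      (∫ a, (𝓕 g₁ : 𝓢(P, ℂ)) a • U (Multiplicative.ofAdd a) χ) +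
        ∫ a, (𝓕 g₂ : 𝓢(P, ℂ)) a • U (Multiplicative.ofAdd a) χ := by
  rw [coe_fourier_add]
  simp_rw [Pi.add_apply]
  exact U.integral_add_smul_apply (𝓕 g₁ : 𝓢(P, ℂ)).integrable (𝓕 g₂ : 𝓢(P, ℂ)).integrable χ

/-- Smearing with `𝓕(g₁ − g₂)`. [folklore] -/
theorem integral_fourier_sub_smul_apply (g₁ g₂ : 𝓢(P, ℂ)) (χ : H) :
    ∫ a, (𝓕 (g₁ - g₂) : 𝓢(P, ℂ)) a • U (Multiplicative.ofAdd a) χ =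
      (∫ a, (𝓕 g₁ : 𝓢(P, ℂ)) a • U (Multiplicative.ofAdd a) χ) -
        ∫ a, (𝓕 g₂ : 𝓢(P, ℂ)) a • U (Multiplicative.ofAdd a) χ := by
  rw [coe_fourier_sub]
  simp_rw [Pi.sub_apply]
  exact U.integral_sub_smul_apply (𝓕 g₁ : 𝓢(P, ℂ)).integrable (𝓕 g₂ : 𝓢(P, ℂ)).integrable χ

/-- The reflected Fourier kernel `𝓕g(−·)` is again the Fourier transform of a Schwartz function,
namely of `𝓕𝓕g = g(−·)`. [folklore] -/
theorem coe_fourier_fourier_fourier (g : 𝓢(P, ℂ)) :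
    ((𝓕 (𝓕 (𝓕 g : 𝓢(P, ℂ)) : 𝓢(P, ℂ)) : 𝓢(P, ℂ)) : P → ℂ) =
      fun b => (𝓕 g : 𝓢(P, ℂ)) (-b) := by
  rw [coe_fourier_fourier_eq_comp_neg (𝓕 g : 𝓢(P, ℂ))]
  rfl

/-- The support of `𝓕𝓕g = g(−·)` is the reflected support of `g`. [folklore] -/
theorem tsupport_fourier_fourier (g : 𝓢(P, ℂ)) :
    tsupport ((𝓕 (𝓕 g : 𝓢(P, ℂ)) : 𝓢(P, ℂ)) : P → ℂ) = (fun ξ : P => -ξ) ⁻¹' tsupport (g : P → ℂ) := by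
  rw [coe_fourier_fourier_eq_comp_neg g, tsupport_comp_eq_preimage]
  rfl

/-- **Spectral condition, reflected form**: if `U` has Fourier spectrum in `C` and the reflected
support `−supp g` misses `(2π)⁻¹ C`, then the vector smeared with the reflected kernel `𝓕g(−·)`
vanishes. [folklore] -/
theorem integral_fourier_comp_neg_smul_apply_eq_zero_of_hasFourierSpectrumIn {C : Set P}
    (hU : U.HasFourierSpectrumIn C) (χ : H) {g : 𝓢(P, ℂ)}
    (hg : tsupport (g : P → ℂ) ⊆ ((fun ξ : P => (2 * Real.pi) • (-ξ)) ⁻¹' C)ᶜ) :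
    ∫ b, (𝓕 g : 𝓢(P, ℂ)) (-b) • U (Multiplicative.ofAdd b) χ = 0 := by
  calc (∫ b, (𝓕 g : 𝓢(P, ℂ)) (-b) • U (Multiplicative.ofAdd b) χ)
      = ∫ b, (𝓕 (𝓕 (𝓕 g : 𝓢(P, ℂ)) : 𝓢(P, ℂ)) : 𝓢(P, ℂ)) b • U (Multiplicative.ofAdd b) χ := by
        congr 1
        funext b
        rw [congrFun (coe_fourier_fourier_fourier g) b]
    _ = 0 := by
        refine U.integral_fourier_smul_apply_eq_zero_of_hasFourierSpectrumIn hU χ ?_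
        rw [tsupport_fourier_fourier]
        intro ξ hξ hξC
        exact hg hξ (by simpa using hξC)

/-! ### The plateau kernels `𝓕Θ_R = Rⁿ 𝓕Θ₁(R·)`: approximate identity and mean ergodic theorem -/

/-- For `R > 0` the Fourier transform of the plateau `Θ_R` is the dilated kernel `a ↦ Rⁿ 𝓕Θ₁(R a)`
(`n = dim P`; `fourier_plateauSchwartz_apply` as an equality of functions). [folklore] -/
theorem coe_fourier_plateauSchwartz {R : ℝ} (hR : 0 < R) :
    ((𝓕 (plateauSchwartz (V := P) hR) : 𝓢(P, ℂ)) : P → ℂ) =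
      fun a : P => (R ^ Module.finrank ℝ P : ℝ) •
        (𝓕 (plateauSchwartz (V := P) one_pos) : 𝓢(P, ℂ)) (R • a) :=
  funext fun a => fourier_plateauSchwartz_apply hR a

/-- The dilated kernels `a ↦ Rⁿ 𝓕Θ₁(R a)` are integrable (`R > 0`). [folklore] -/
theorem integrable_plateauKer {R : ℝ} (hR : 0 < R) :
    Integrable fun a : P => (R ^ Module.finrank ℝ P : ℝ) •
      (𝓕 (plateauSchwartz (V := P) one_pos) : 𝓢(P, ℂ)) (R • a) := by
  rw [← coe_fourier_plateauSchwartz hR]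
  exact (𝓕 (plateauSchwartz (V := P) hR) : 𝓢(P, ℂ)).integrable

/-- The dilated kernels all have the same `L¹` norm: `∫ ‖Rⁿ 𝓕Θ₁(R a)‖ da = ∫ ‖𝓕Θ₁‖` (`R > 0`). [folklore] -/
theorem integral_norm_plateauKer {R : ℝ} (hR : 0 < R) :
    ∫ a, ‖(R ^ Module.finrank ℝ P : ℝ) • (𝓕 (plateauSchwartz (V := P) one_pos) : 𝓢(P, ℂ)) (R • a)‖ =
      ∫ v, ‖(𝓕 (plateauSchwartz (V := P) one_pos) : 𝓢(P, ℂ)) v‖ := by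
  set n : ℕ := Module.finrank ℝ P with hn
  have h1 : (fun a => ‖(R ^ n : ℝ) • (𝓕 (plateauSchwartz (V := P) one_pos) : 𝓢(P, ℂ)) (R • a)‖) =
      fun a => (fun v => (R ^ n : ℝ) * ‖(𝓕 (plateauSchwartz (V := P) one_pos) : 𝓢(P, ℂ)) v‖)
        (R • a) := by
    funext a
    rw [norm_smul, Real.norm_eq_abs, abs_of_pos (pow_pos hR n)]
  rw [h1, Measure.integral_comp_smul_of_nonneg volume
    (fun v => (R ^ n : ℝ) * ‖(𝓕 (plateauSchwartz (V := P) one_pos) : 𝓢(P, ℂ)) v‖) R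
    (hR := hR.le), integral_const_mul, smul_eq_mul, ← mul_assoc,
    inv_mul_cancel₀ (pow_ne_zero _ hR.ne'), one_mul]

/-- Uniform bound for smearing with the dilated kernels:
`‖∫ Rⁿ𝓕Θ₁(Ra) U(a) v da‖ ≤ ‖𝓕Θ₁‖₁ ‖v‖` for every `R > 0`. [folklore] -/
theorem norm_integral_plateauKer_smul_apply_le {R : ℝ} (hR : 0 < R) (v : H) :
    ‖∫ a, ((R ^ Module.finrank ℝ P : ℝ) • (𝓕 (plateauSchwartz (V := P) one_pos) : 𝓢(P, ℂ)) (R • a)) •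
        U (Multiplicative.ofAdd a) v‖ ≤
      (∫ w, ‖(𝓕 (plateauSchwartz (V := P) one_pos) : 𝓢(P, ℂ)) w‖) * ‖v‖ := by
  rw [← integral_norm_plateauKer hR]
  exact U.norm_integral_smul_apply_le _ v

/-- Rescaling the smeared vector: `∫ Rⁿ𝓕Θ₁(Ra) U(a) η da = ∫ 𝓕Θ₁(v) U(v/R) η dv` (`R > 0`). [folklore] -/
theorem integral_plateauKer_smul_apply_eq {R : ℝ} (hR : 0 < R) (η : H) :
    ∫ a, ((R ^ Module.finrank ℝ P : ℝ) • (𝓕 (plateauSchwartz (V := P) one_pos) : 𝓢(P, ℂ)) (R • a)) •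
        U (Multiplicative.ofAdd a) η =
      ∫ v, (𝓕 (plateauSchwartz (V := P) one_pos) : 𝓢(P, ℂ)) v •
        U (Multiplicative.ofAdd (R⁻¹ • v)) η := by
  set k : P → ℂ := ⇑(𝓕 (plateauSchwartz (V := P) one_pos) : 𝓢(P, ℂ)) with hk
  set n : ℕ := Module.finrank ℝ P with hn
  have h1 : (fun a => ((R ^ n : ℝ) • k (R • a)) • U (Multiplicative.ofAdd a) η) =
      fun a => (fun v => (R ^ n : ℝ) • (k v • U (Multiplicative.ofAdd (R⁻¹ • v)) η)) (R • a) := by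
    funext a
    simp only [smul_assoc, inv_smul_smul₀ hR.ne']
  rw [h1, Measure.integral_comp_smul_of_nonneg volume
      (fun v => (R ^ n : ℝ) • (k v • U (Multiplicative.ofAdd (R⁻¹ • v)) η)) R (hR := hR.le),
    integral_smul, smul_smul, inv_mul_cancel₀ (pow_ne_zero _ hR.ne'), one_smul]

/-- **Approximate identity**: `∫ Rⁿ𝓕Θ₁(Ra) U(a) η da → η` as `R → ∞` — the kernels have integral
`1` and concentrate at the origin, and `U` is strongly continuous (in SNAG language
`Θ_R(P/2π) → 1` strongly; Reed–Simon I, §VIII.4). [folklore] -/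
theorem tendsto_integral_plateauKer_smul_apply_atTop (η : H) :
    Tendsto (fun R : ℝ => ∫ a, ((R ^ Module.finrank ℝ P : ℝ) •
        (𝓕 (plateauSchwartz (V := P) one_pos) : 𝓢(P, ℂ)) (R • a)) • U (Multiplicative.ofAdd a) η)
      atTop (𝓝 η) := by
  set k : P → ℂ := ⇑(𝓕 (plateauSchwartz (V := P) one_pos) : 𝓢(P, ℂ)) with hk
  have hkint : Integrable k := (𝓕 (plateauSchwartz (V := P) one_pos) : 𝓢(P, ℂ)).integrable
  have hkcont : Continuous k := (𝓕 (plateauSchwartz (V := P) one_pos) : 𝓢(P, ℂ)).continuous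
  -- the rescaled integrals converge by dominated convergence
  have hlim : Tendsto (fun R : ℝ => ∫ v, k v • U (Multiplicative.ofAdd (R⁻¹ • v)) η) atTop
      (𝓝 (∫ v, k v • η)) := by
    refine tendsto_integral_filter_of_dominated_convergence (fun v => ‖k v‖ * ‖η‖) ?_ ?_
      (hkint.norm.mul_const _) ?_
    · exact Eventually.of_forall fun R =>
        (hkcont.aestronglyMeasurable.smul
          ((U.continuous_apply_ofAdd η).comp (continuous_const.smul continuous_id)).aestronglyMeasurable)
    · exact Eventually.of_forall fun R => Eventually.of_forall fun v => by
        rw [norm_smul, U.norm_map]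
    · refine Eventually.of_forall fun v => Tendsto.smul tendsto_const_nhds ?_
      have h1 : Tendsto (fun R : ℝ => R⁻¹ • v) atTop (𝓝 ((0 : ℝ) • v)) :=
        tendsto_inv_atTop_zero.smul_const v
      rw [zero_smul] at h1
      have h2 := ((U.continuous_apply_ofAdd η).tendsto (0 : P)).comp h1
      simpa [Function.comp_def] using h2
  have hval : ∫ v, k v • η = η := by
    rw [integral_smul_const, hk, integral_fourier_plateauSchwartz_one, one_smul]
  rw [hval] at hlim
  refine hlim.congr' ?_
  filter_upwards [eventually_gt_atTop 0] with R hR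
  exact (U.integral_plateauKer_smul_apply_eq hR η).symm

/-- **Approximate identity, `∃`-form**: for every `δ > 0` there is `R > 0` with
`‖η − ∫ 𝓕Θ_R(a) U(a) η da‖ < δ`. [folklore] -/
theorem exists_norm_sub_integral_fourier_plateauSchwartz_lt (η : H) {δ : ℝ} (hδ : 0 < δ) :
    ∃ (R : ℝ) (hR : 0 < R),
      ‖η - ∫ a, (𝓕 (plateauSchwartz (V := P) hR) : 𝓢(P, ℂ)) a • U (Multiplicative.ofAdd a) η‖ < δ := by
  have h := Metric.tendsto_nhds.1 (U.tendsto_integral_plateauKer_smul_apply_atTop η) δ hδ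
  obtain ⟨R, hR⟩ := (h.and (eventually_gt_atTop 0)).exists
  refine ⟨R, hR.2, ?_⟩
  simp_rw [fourier_plateauSchwartz_apply hR.2]
  rw [← dist_eq_norm, dist_comm]
  exact hR.1

/-- On the vectors `U(y)ζ − ζ` the wide averages are small:
`‖∫ εⁿ𝓕Θ₁(εa) U(a) (U(y)ζ − ζ) da‖ ≤ ‖ζ‖ ∫ |𝓕Θ₁(w + εy) − 𝓕Θ₁(w)| dw` (`ε > 0`). [folklore] -/
theorem norm_integral_plateauKer_smul_apply_apply_sub_le {ε : ℝ} (hε : 0 < ε) (y : P) (ζ : H) :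
    ‖∫ a, ((ε ^ Module.finrank ℝ P : ℝ) • (𝓕 (plateauSchwartz (V := P) one_pos) : 𝓢(P, ℂ)) (ε • a)) •
        U (Multiplicative.ofAdd a) (U (Multiplicative.ofAdd y) ζ - ζ)‖ ≤
      (∫ w, ‖(𝓕 (plateauSchwartz (V := P) one_pos) : 𝓢(P, ℂ)) (w + ε • y) -
        (𝓕 (plateauSchwartz (V := P) one_pos) : 𝓢(P, ℂ)) w‖) * ‖ζ‖ := by
  have hint := integrable_plateauKer (P := P) hε
  rw [U.integral_smul_apply_sub hint]
  refine (U.norm_integral_smul_apply_apply_sub_le hint y ζ).trans (le_of_eq ?_)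
  congr 1
  have h := integral_norm_scaled_translate_sub (𝓕 (plateauSchwartz (V := P) one_pos) : 𝓢(P, ℂ))
    hε y 0
  simp only [sub_zero] at h
  exact h

/-- On the vectors `U(y)ζ − ζ` the wide averages tend to zero as `ε → 0⁺` (continuity of
translation in `L¹` for the Schwartz kernel `𝓕Θ₁`). [folklore] -/
theorem tendsto_integral_plateauKer_smul_apply_apply_sub (y : P) (ζ : H) :
    Tendsto (fun ε : ℝ => ∫ a, ((ε ^ Module.finrank ℝ P : ℝ) •
        (𝓕 (plateauSchwartz (V := P) one_pos) : 𝓢(P, ℂ)) (ε • a)) •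
          U (Multiplicative.ofAdd a) (U (Multiplicative.ofAdd y) ζ - ζ)) (𝓝[>] 0) (𝓝 0) := by
  set k : P → ℂ := ⇑(𝓕 (plateauSchwartz (V := P) one_pos) : 𝓢(P, ℂ)) with hk
  have h1 : Tendsto (fun ε : ℝ => ε • y) (𝓝[>] 0) (𝓝 0) := by
    have : Tendsto (fun ε : ℝ => ε • y) (𝓝 0) (𝓝 ((0 : ℝ) • y)) := tendsto_id.smul_const _
    rw [zero_smul] at this
    exact this.mono_left nhdsWithin_le_nhds
  have h2 : Tendsto (fun ε : ℝ => (∫ w, ‖k (w + ε • y) - k w‖) * ‖ζ‖) (𝓝[>] 0) (𝓝 (0 * ‖ζ‖)) :=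
    ((tendsto_integral_norm_translate_sub
      (𝓕 (plateauSchwartz (V := P) one_pos) : 𝓢(P, ℂ))).comp h1).mul_const _
  rw [zero_mul] at h2
  refine squeeze_zero_norm' ?_ h2
  filter_upwards [self_mem_nhdsWithin] with ε hε
  exact U.norm_integral_plateauKer_smul_apply_apply_sub_le hε y ζ

/-- The wide averages tend to zero on the span of the vectors `U(y)ζ − ζ`. [folklore] -/
theorem tendsto_integral_plateauKer_smul_apply_of_mem_span {v : H}
    (hv : v ∈ Submodule.span ℂ {v : H | ∃ (y : P) (ζ : H), v = U (Multiplicative.ofAdd y) ζ - ζ}) :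
    Tendsto (fun ε : ℝ => ∫ a, ((ε ^ Module.finrank ℝ P : ℝ) •
        (𝓕 (plateauSchwartz (V := P) one_pos) : 𝓢(P, ℂ)) (ε • a)) • U (Multiplicative.ofAdd a) v)
      (𝓝[>] 0) (𝓝 0) := by
  induction hv using Submodule.span_induction with
  | mem x hx =>
    obtain ⟨y, ζ, rfl⟩ := hx
    exact U.tendsto_integral_plateauKer_smul_apply_apply_sub y ζ
  | zero =>
    simp only [map_zero, smul_zero, integral_zero]
    exact tendsto_const_nhds
  | add x y _ _ hx hy =>
    have h := hx.add hy
    rw [add_zero] at h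
    refine h.congr' ?_
    filter_upwards [self_mem_nhdsWithin] with ε hε
    exact (U.integral_smul_apply_add (integrable_plateauKer hε) x y).symm
  | smul c x _ hx =>
    have h := hx.const_smul c
    rw [smul_zero] at h
    refine h.congr' (Eventually.of_forall fun ε => ?_)
    exact (U.integral_smul_apply_smul _ c x).symm

/-- **Weighted mean ergodic theorem at a unique vacuum**: if `Ω` is, up to scalars, the unique
invariant vector of `U` (`HasUniqueVacuum`) and `⟪Ω, χ⟫ = 0`, then the wide plateau averages of
the orbit of `χ` tend to zero, `∫ εⁿ𝓕Θ₁(εa) U(a) χ da → 0` as `ε → 0⁺` (in SNAG language: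
`Θ₁(P/2πε) χ → E({0}) χ = 0`; von Neumann's mean ergodic theorem, Reed–Simon I Thm. II.11, for
the abelian group of translations with the `L¹` weights `εⁿ𝓕Θ₁(ε·)`). [cite: ReedSimonI1980, Thm II.11] -/
theorem tendsto_integral_plateauKer_smul_apply_nhdsWithin_zero {Ω : H} (hΩ : U.HasUniqueVacuum Ω)
    {χ : H} (hχ : ⟪Ω, χ⟫_ℂ = 0) :
    Tendsto (fun ε : ℝ => ∫ a, ((ε ^ Module.finrank ℝ P : ℝ) •
        (𝓕 (plateauSchwartz (V := P) one_pos) : 𝓢(P, ℂ)) (ε • a)) • U (Multiplicative.ofAdd a) χ)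
      (𝓝[>] 0) (𝓝 0) := by
  set K : ℝ := ∫ w, ‖(𝓕 (plateauSchwartz (V := P) one_pos) : 𝓢(P, ℂ)) w‖ with hK
  have hK0 : 0 ≤ K := integral_nonneg fun w => norm_nonneg _
  rw [Metric.tendsto_nhds]
  intro δ hδ
  have hδ' : 0 < δ / (2 * (K + 1)) := by positivity
  obtain ⟨v, hv, hdist⟩ := Metric.mem_closure_iff.1 (U.mem_closure_span_apply_sub hΩ hχ) _ hδ'
  have hvlim := Metric.tendsto_nhds.1 (U.tendsto_integral_plateauKer_smul_apply_of_mem_span hv) (δ / 2)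
    (by positivity)
  filter_upwards [hvlim, self_mem_nhdsWithin] with ε hε hε0
  rw [dist_zero_right] at hε ⊢
  have hint := integrable_plateauKer (P := P) hε0
  have hsplit := U.integral_smul_apply_add hint (χ - v) v
  rw [sub_add_cancel] at hsplit
  rw [hsplit]
  have h1 : ‖∫ a, ((ε ^ Module.finrank ℝ P : ℝ) •
      (𝓕 (plateauSchwartz (V := P) one_pos) : 𝓢(P, ℂ)) (ε • a)) • U (Multiplicative.ofAdd a) (χ - v)‖ ≤
      K * (δ / (2 * (K + 1))) :=
    (U.norm_integral_plateauKer_smul_apply_le hε0 _).trans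
      (mul_le_mul_of_nonneg_left (by rw [← dist_eq_norm]; exact hdist.le) hK0)
  have h2 : K * (δ / (2 * (K + 1))) ≤ δ / 2 := by
    rw [mul_div_assoc', div_le_div_iff₀ (by positivity) (by positivity)]
    nlinarith
  exact (norm_add_le _ _).trans_lt
    ((add_lt_add_of_le_of_lt (h1.trans h2) hε).trans_eq (by ring))

/-- **Mean ergodic theorem, `∃`-form**: for `χ ⊥ Ω` and every `δ > 0` there is `ε > 0` with
`‖∫ 𝓕Θ_ε(a) U(a) χ da‖ < δ`. [folklore] -/
theorem exists_norm_integral_fourier_plateauSchwartz_lt {Ω : H} (hΩ : U.HasUniqueVacuum Ω) {χ : H}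
    (hχ : ⟪Ω, χ⟫_ℂ = 0) {δ : ℝ} (hδ : 0 < δ) :
    ∃ (ε : ℝ) (hε : 0 < ε),
      ‖∫ a, (𝓕 (plateauSchwartz (V := P) hε) : 𝓢(P, ℂ)) a • U (Multiplicative.ofAdd a) χ‖ < δ := by
  have h := Metric.tendsto_nhds.1 (U.tendsto_integral_plateauKer_smul_apply_nhdsWithin_zero hΩ hχ) δ hδ
  obtain ⟨ε, hε⟩ := (h.and self_mem_nhdsWithin).exists
  refine ⟨ε, hε.2, ?_⟩
  simp_rw [fourier_plateauSchwartz_apply hε.2]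
  simpa [dist_zero_right] using hε.1

end UnitaryRep

/-! ### Splitting a compactly supported test function over a binary open cover -/

section Split

open scoped Manifold ContDiff

variable {E : Type*} [NormedAddCommGroup E] [NormedSpace ℝ E] [FiniteDimensional ℝ E]

/-- **Splitting a compactly supported test function over two open sets**: if `supp G` is compact
and contained in `U₁ ∪ U₂`, then `G = G₁ + G₂` with Schwartz `Gᵢ` supported in `Uᵢ` (smooth
partition of unity on `supp G` subordinate to the cover, times a compactly supported cutoff equal
to `1` on `supp G`; Hörmander I, Thm. 1.4.4 / Thm. 2.2.1). [cite: HormanderALPDO1, Thm. 1.4.4] -/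
theorem exists_add_of_tsupport_subset_union {U₁ U₂ : Set E} (hU₁ : IsOpen U₁) (hU₂ : IsOpen U₂)
    (G : 𝓢(E, ℂ)) (hGc : HasCompactSupport (G : E → ℂ)) (hG : tsupport (G : E → ℂ) ⊆ U₁ ∪ U₂) :
    ∃ G₁ G₂ : 𝓢(E, ℂ), G = G₁ + G₂ ∧ tsupport (G₁ : E → ℂ) ⊆ U₁ ∧ tsupport (G₂ : E → ℂ) ⊆ U₂ := by
  let V : Fin 2 → Set E := ![U₁, U₂]
  have hV : ∀ i, IsOpen (V i) := by
    intro i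
    fin_cases i
    · exact hU₁
    · exact hU₂
  have hGV : tsupport (G : E → ℂ) ⊆ ⋃ i, V i := by
    intro x hx
    rcases hG hx with h | h
    · exact Set.mem_iUnion.2 ⟨0, h⟩
    · exact Set.mem_iUnion.2 ⟨1, h⟩
  -- smooth partition of unity on `tsupport G` subordinate to `V`
  obtain ⟨ρ, hρ⟩ :=
    SmoothPartitionOfUnity.exists_isSubordinate 𝓘(ℝ, E) (isClosed_tsupport _) V hV hGV
  -- a compactly supported smooth cutoff equal to one on `tsupport G`
  obtain ⟨θ, hθs, hθc, -, hθ1, -⟩ :=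
    Literature.Analysis.FunctionSpaces.SchwartzSupport.exists_smooth_one_of_isCompact_subset_isOpen
      hGc isOpen_univ (Set.subset_univ _)
  let χ : Fin 2 → E → ℂ := fun i x => ((θ x * ρ i x : ℝ) : ℂ)
  have hχs : ∀ i, ContDiff ℝ ∞ (χ i) := fun i =>
    (Complex.ofRealCLM.contDiff.comp (hθs.mul ((ρ i).contMDiff.contDiff)))
  have hχc : ∀ i, HasCompactSupport (χ i) := fun i =>
    (hθc.mul_right (f' := fun x => ρ i x)).comp_left (g := fun r : ℝ => (r : ℂ)) Complex.ofReal_zero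
  have hχU : ∀ i, tsupport (χ i) ⊆ V i := fun i =>
    (tsupport_comp_subset Complex.ofReal_zero _).trans ((tsupport_mul_subset_right).trans (hρ i))
  let Gi : Fin 2 → 𝓢(E, ℂ) := fun i => SchwartzMap.smulLeftCLM ℂ (χ i) G
  have hcoe : ∀ i, (Gi i : E → ℂ) = fun x => χ i x * G x := fun i =>
    funext fun x =>
      Literature.Analysis.FunctionSpaces.SchwartzSupport.smulLeftCLM_apply_of_hasCompactSupport
        (hχs i) (hχc i) G x
  have hsum : G = ∑ i, Gi i := by
    ext x
    have hx' : (∑ i, Gi i) x = ∑ i, χ i x * G x := by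
      rw [show ((∑ i, Gi i : 𝓢(E, ℂ)) : E → ℂ) x = ∑ i, (Gi i : E → ℂ) x from
        sum_apply _ _ _]
      exact Finset.sum_congr rfl fun i _ => by rw [hcoe]
    rw [hx', ← Finset.sum_mul]
    by_cases hx : x ∈ tsupport (G : E → ℂ)
    · have : ∑ i, χ i x = 1 := by
        simp only [χ, ← Complex.ofReal_sum, hθ1 x hx, one_mul]
        rw [← finsum_eq_sum_of_fintype, ρ.sum_eq_one hx, Complex.ofReal_one]
      rw [this, one_mul]
    · rw [image_eq_zero_of_notMem_tsupport hx, mul_zero]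
  refine ⟨Gi 0, Gi 1, ?_, ?_, ?_⟩
  · rw [hsum, Fin.sum_univ_two]
  · rw [hcoe]
    exact (tsupport_mul_subset_left).trans (hχU 0)
  · rw [hcoe]
    exact (tsupport_mul_subset_left).trans (hχU 1)

end Split

namespace UnitaryRep

variable (U : UnitaryRep (Multiplicative P) H)

/-! ### Density: `χ ⊥ Ω` is approximated by `∫ 𝓕g(a) U(a) χ da` with `supp g` off `−(2π)⁻¹C` -/

/-- **Spectral approximation of vectors orthogonal to the vacuum.** Let `U` have Fourier spectrum
in a closed set `C` with `C ∩ (−C) ⊆ {0}` (e.g. the closed forward light cone) and a unique vacuum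
`Ω`. Then every `χ ⊥ Ω` is approximated in norm by smeared vectors `∫ 𝓕g(a) U(a) χ da` with
Schwartz `g` supported off `−(2π)⁻¹C` (in SNAG language: `χ = lim g(P/2π) χ` with `g` vanishing
near `−C`, because the spectral measure of `χ` lives on `C` and has no atom at `p = 0`). Proof:
`χ ≈ 𝓕Θ_R`-smearing (approximate identity) `≈ 𝓕(Θ_R − Θ_ε)`-smearing (mean ergodic theorem), and
`Θ_R − Θ_ε`, supported in an annulus, splits into a part supported off `−(2π)⁻¹C` and a part
supported off `(2π)⁻¹C`, the latter smearing `χ` to `0` by the spectral condition. [folklore] -/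
theorem exists_integral_fourier_sub_lt {C : Set P} (hC : IsClosed C) (hC0 : ∀ p ∈ C, -p ∈ C → p = 0)
    (hU : U.HasFourierSpectrumIn C) {Ω : H} (hΩ : U.HasUniqueVacuum Ω) {χ : H}
    (hχ : ⟪Ω, χ⟫_ℂ = 0) {δ : ℝ} (hδ : 0 < δ) :
    ∃ g : 𝓢(P, ℂ), tsupport (g : P → ℂ) ⊆ ((fun ξ : P => (2 * Real.pi) • (-ξ)) ⁻¹' C)ᶜ ∧
      ‖χ - ∫ a, (𝓕 g : 𝓢(P, ℂ)) a • U (Multiplicative.ofAdd a) χ‖ < δ := by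
  -- `R` large (approximate identity), `ε` small (mean ergodic theorem)
  obtain ⟨R, hR, hRχ⟩ := U.exists_norm_sub_integral_fourier_plateauSchwartz_lt χ (half_pos hδ)
  obtain ⟨ε, hε, hεχ⟩ := U.exists_norm_integral_fourier_plateauSchwartz_lt hΩ hχ (half_pos hδ)
  -- the difference of the plateaus is supported in an annulus, hence off `(2π)⁻¹C ∩ −(2π)⁻¹C`
  set g₀ : 𝓢(P, ℂ) := plateauSchwartz (V := P) hR - plateauSchwartz hε with hg₀
  have hg₀c : HasCompactSupport (g₀ : P → ℂ) := by
    have : HasCompactSupport ((plateau (V := P) R) - plateau ε) :=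
      (hasCompactSupport_plateau hR).sub (hasCompactSupport_plateau hε)
    exact this
  have h0 : (0 : P) ∉ tsupport (g₀ : P → ℂ) := zero_notMem_tsupport_plateauSchwartz_sub hR hε
  have hC'closed : IsClosed ((fun ξ : P => (2 * Real.pi) • ξ) ⁻¹' C) :=
    hC.preimage (continuous_const_smul _)
  have hC''closed : IsClosed ((fun ξ : P => (2 * Real.pi) • (-ξ)) ⁻¹' C) :=
    hC.preimage (continuous_neg.const_smul _)
  have hcover : tsupport (g₀ : P → ℂ) ⊆
      ((fun ξ : P => (2 * Real.pi) • (-ξ)) ⁻¹' C)ᶜ ∪ ((fun ξ : P => (2 * Real.pi) • ξ) ⁻¹' C)ᶜ := by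
    intro ξ hξ
    have hξ0 : ξ ≠ 0 := fun h => h0 (h ▸ hξ)
    by_contra hcon
    simp only [Set.mem_union, Set.mem_compl_iff, Set.mem_preimage, not_or, not_not, smul_neg] at hcon
    have h1 := hC0 _ hcon.2 hcon.1
    rw [smul_eq_zero] at h1
    rcases h1 with h1 | h1
    · exact absurd h1 (by positivity)
    · exact hξ0 h1
  obtain ⟨g₁, g₂, hsum, hg₁, hg₂⟩ := exists_add_of_tsupport_subset_union hC''closed.isOpen_compl
    hC'closed.isOpen_compl g₀ hg₀c hcover
  refine ⟨g₁, hg₁, ?_⟩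
  have h2 : ∫ a, (𝓕 g₂ : 𝓢(P, ℂ)) a • U (Multiplicative.ofAdd a) χ = 0 :=
    U.integral_fourier_smul_apply_eq_zero_of_hasFourierSpectrumIn hU χ hg₂
  have hsm : ∫ a, (𝓕 g₁ : 𝓢(P, ℂ)) a • U (Multiplicative.ofAdd a) χ =
      (∫ a, (𝓕 (plateauSchwartz (V := P) hR) : 𝓢(P, ℂ)) a • U (Multiplicative.ofAdd a) χ) -
        ∫ a, (𝓕 (plateauSchwartz (V := P) hε) : 𝓢(P, ℂ)) a • U (Multiplicative.ofAdd a) χ := by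
    have h := U.integral_fourier_add_smul_apply g₁ g₂ χ
    rw [← hsum, h2, add_zero, hg₀, U.integral_fourier_sub_smul_apply] at h
    exact h.symm
  rw [hsm]
  calc ‖χ - ((∫ a, (𝓕 (plateauSchwartz (V := P) hR) : 𝓢(P, ℂ)) a • U (Multiplicative.ofAdd a) χ) -
        ∫ a, (𝓕 (plateauSchwartz (V := P) hε) : 𝓢(P, ℂ)) a • U (Multiplicative.ofAdd a) χ)‖
      = ‖(χ - ∫ a, (𝓕 (plateauSchwartz (V := P) hR) : 𝓢(P, ℂ)) a • U (Multiplicative.ofAdd a) χ) +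
          ∫ a, (𝓕 (plateauSchwartz (V := P) hε) : 𝓢(P, ℂ)) a • U (Multiplicative.ofAdd a) χ‖ := by
        congr 1
        abel
    _ ≤ ‖χ - ∫ a, (𝓕 (plateauSchwartz (V := P) hR) : 𝓢(P, ℂ)) a • U (Multiplicative.ofAdd a) χ‖ +
          ‖∫ a, (𝓕 (plateauSchwartz (V := P) hε) : 𝓢(P, ℂ)) a • U (Multiplicative.ofAdd a) χ‖ :=
        norm_add_le _ _
    _ < δ / 2 + δ / 2 := add_lt_add hRχ hεχ
    _ = δ := by ring

/-! ### The cluster theorem -/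

/-- **Cluster theorem for unitary representations of translation groups** (the Hilbert-space
core of the cluster decomposition property, Streater–Wightman (1964), §3-4, Thm. 3-4, in the
general form — no mass gap — of Araki–Hepp–Ruelle, Helv. Phys. Acta 35 (1962) 164). Let `U` have
Fourier spectrum in a closed set `C` with `C ∩ (−C) ⊆ {0}` and a unique vacuum `Ω`, `‖Ω‖ = 1`.
Suppose two matrix coefficients are *locally exchanged* on a set `S`:
`⟪ψ₁, U(s) χ₁⟫ = ⟪ψ₂, U(−s) χ₂⟫` for `s ∈ S` (for fields: `⟪Ω, A U(s) B Ω⟫ = ⟪Ω, B_s A Ω⟫ at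
spacelike `s`, locality), with matching vacuum contributions
`⟪ψ₁, Ω⟫⟪Ω, χ₁⟫ = ⟪ψ₂, Ω⟫⟪Ω, χ₂⟫`. Then along every path `x t` that eventually absorbs each
translate of `S` (`x t + z ∈ S` eventually, for every `z`),
`⟪ψ₁, U(x t) χ₁⟫ → ⟪ψ₁, Ω⟫⟪Ω, χ₁⟫`. Proof: subtract the vacuum part (`χ₁' = χ₁ − ⟪Ω,χ₁⟫Ω`),
approximate `χ₁'` by `∫ 𝓕g(a) U(a) χ₁' da` with `supp g` off `−(2π)⁻¹C`
(`exists_integral_fourier_sub_lt`); the smeared coefficient is the correlation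
`∫ 𝓕g(a) F₁(x + a) da` of `F₁ = ⟪ψ₁, U(·) χ₁'⟫`, the partner correlation of `F₂ = ⟪ψ₂, U(−·) χ₂'⟫`
vanishes identically by the spectral condition (reflected support), and
`∫ 𝓕g(a) (F₁ − F₂)(x t + a) da → 0` by dominated convergence since `F₁ = F₂` on `S`. [cite: ArakiHeppRuelle1962, Thm (cluster property, no mass gap); SW Thm 3-4] -/
theorem tendsto_inner_apply_of_eqOn {C : Set P} (hC : IsClosed C) (hC0 : ∀ p ∈ C, -p ∈ C → p = 0)
    (hU : U.HasFourierSpectrumIn C) {Ω : H} (hΩ : U.HasUniqueVacuum Ω) (hΩ1 : ‖Ω‖ = 1)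
    {ψ₁ χ₁ ψ₂ χ₂ : H} {S : Set P}
    (hloc : ∀ s ∈ S, ⟪ψ₁, U (Multiplicative.ofAdd s) χ₁⟫_ℂ = ⟪ψ₂, U (Multiplicative.ofAdd (-s)) χ₂⟫_ℂ)
    (hc : ⟪ψ₁, Ω⟫_ℂ * ⟪Ω, χ₁⟫_ℂ = ⟪ψ₂, Ω⟫_ℂ * ⟪Ω, χ₂⟫_ℂ)
    {ι : Type*} {l : Filter ι} [l.IsCountablyGenerated] {x : ι → P}
    (hx : ∀ z : P, ∀ᶠ t in l, x t + z ∈ S) :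
    Tendsto (fun t => ⟪ψ₁, U (Multiplicative.ofAdd (x t)) χ₁⟫_ℂ) l
      (𝓝 (⟪ψ₁, Ω⟫_ℂ * ⟪Ω, χ₁⟫_ℂ)) := by
  set c : ℂ := ⟪ψ₁, Ω⟫_ℂ * ⟪Ω, χ₁⟫_ℂ with hc_def
  set χ₁' : H := χ₁ - ⟪Ω, χ₁⟫_ℂ • Ω with hχ₁'_def
  set χ₂' : H := χ₂ - ⟪Ω, χ₂⟫_ℂ • Ω with hχ₂'_def
  have hUΩ : ∀ y : P, U (Multiplicative.ofAdd y) Ω = Ω := fun y =>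
    (U.mem_invariantVectors_iff Ω).1 hΩ.1.1 _
  have hΩΩ : ⟪Ω, Ω⟫_ℂ = 1 := by
    rw [inner_self_eq_norm_sq_to_K, hΩ1]
    simp
  have hχ₁' : ⟪Ω, χ₁'⟫_ℂ = 0 := by
    rw [hχ₁'_def, inner_sub_right, inner_smul_right, hΩΩ, mul_one, sub_self]
  -- the vacuum-subtracted matrix coefficients
  set F₁ : P → ℂ := fun y => ⟪ψ₁, U (Multiplicative.ofAdd y) χ₁'⟫_ℂ with hF₁_def
  set F₂ : P → ℂ := fun y => ⟪ψ₂, U (Multiplicative.ofAdd (-y)) χ₂'⟫_ℂ with hF₂_def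
  have hF₁ : ∀ y, F₁ y = ⟪ψ₁, U (Multiplicative.ofAdd y) χ₁⟫_ℂ - c := by
    intro y
    simp only [hF₁_def, hχ₁'_def, map_sub, map_smul, inner_sub_right, inner_smul_right, hUΩ, hc_def]
    ring
  have hF₂ : ∀ y, F₂ y = ⟪ψ₂, U (Multiplicative.ofAdd (-y)) χ₂⟫_ℂ - c := by
    intro y
    simp only [hF₂_def, hχ₂'_def, map_sub, map_smul, inner_sub_right, inner_smul_right, hUΩ, hc]
    ring
  have hF₁F₂ : ∀ s ∈ S, F₁ s = F₂ s := fun s hs => by rw [hF₁, hF₂, hloc s hs]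
  have hF₁b : ∀ y, ‖F₁ y‖ ≤ ‖ψ₁‖ * ‖χ₁'‖ := fun y => U.norm_inner_apply_ofAdd_le _ _ _
  have hF₂b : ∀ y, ‖F₂ y‖ ≤ ‖ψ₂‖ * ‖χ₂'‖ := fun y => U.norm_inner_apply_ofAdd_le _ _ _
  have hF₁c : Continuous F₁ := continuous_const.inner (U.continuous_apply_ofAdd χ₁')
  have hF₂c : Continuous F₂ :=
    continuous_const.inner ((U.continuous_apply_ofAdd χ₂').comp continuous_neg)
  -- reduction to `F₁ (x t) → 0`
  suffices h : Tendsto (fun t => F₁ (x t)) l (𝓝 0) by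
    have := h.add_const c
    simpa [hF₁] using this
  rw [Metric.tendsto_nhds]
  intro δ hδ
  -- approximate `χ₁'` by a smeared vector with kernel `𝓕g`, `supp g` off `−(2π)⁻¹C`
  have hδ' : 0 < δ / (2 * (‖ψ₁‖ + 1)) := by positivity
  obtain ⟨g, hg, hgχ⟩ := U.exists_integral_fourier_sub_lt hC hC0 hU hΩ hχ₁' hδ'
  set v : H := ∫ a, (𝓕 g : 𝓢(P, ℂ)) a • U (Multiplicative.ofAdd a) χ₁' with hv
  have hgint : Integrable ((𝓕 g : 𝓢(P, ℂ)) : P → ℂ) := (𝓕 g : 𝓢(P, ℂ)).integrable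
  -- the smeared coefficient is a correlation of `F₁`
  have hG : ∀ y, ⟪ψ₁, U (Multiplicative.ofAdd y) v⟫_ℂ = ∫ a, (𝓕 g : 𝓢(P, ℂ)) a * F₁ (y + a) :=
    fun y => U.inner_apply_integral_smul_apply hgint ψ₁ χ₁' y
  -- the partner correlation of `F₂` vanishes by the spectral condition
  have hG₂ : ∀ y, ∫ a, (𝓕 g : 𝓢(P, ℂ)) a * F₂ (y + a) = 0 := by
    intro y
    have h := U.inner_apply_neg_integral_smul_apply_comp_neg hgint ψ₂ χ₂' y
    rw [U.integral_fourier_comp_neg_smul_apply_eq_zero_of_hasFourierSpectrumIn hU χ₂' hg, map_zero,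
      inner_zero_right] at h
    exact h.symm
  -- integrability of the correlation integrands
  have hI₁ : ∀ y, Integrable fun a => (𝓕 g : 𝓢(P, ℂ)) a * F₁ (y + a) := fun y =>
    integrable_fourier_mul (hF₁c.comp (continuous_const.add continuous_id)) (fun a => hF₁b (y + a)) g
  have hI₂ : ∀ y, Integrable fun a => (𝓕 g : 𝓢(P, ℂ)) a * F₂ (y + a) := fun y =>
    integrable_fourier_mul (hF₂c.comp (continuous_const.add continuous_id)) (fun a => hF₂b (y + a)) g
  -- dominated convergence: `∫ 𝓕g(a) (F₁ − F₂)(x t + a) da → 0`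
  have hDC : Tendsto (fun t => ∫ a, (𝓕 g : 𝓢(P, ℂ)) a * (F₁ (x t + a) - F₂ (x t + a))) l (𝓝 0) := by
    have h := tendsto_integral_filter_of_dominated_convergence (l := l)
      (F := fun t a => (𝓕 g : 𝓢(P, ℂ)) a * (F₁ (x t + a) - F₂ (x t + a))) (f := fun _ => (0 : ℂ))
      (fun a => ‖(𝓕 g : 𝓢(P, ℂ)) a‖ * (‖ψ₁‖ * ‖χ₁'‖ + ‖ψ₂‖ * ‖χ₂'‖)) ?_ ?_
      (hgint.norm.mul_const _) ?_
    · simpa using h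
    · exact Eventually.of_forall fun t =>
        ((𝓕 g : 𝓢(P, ℂ)).continuous.mul ((hF₁c.comp (continuous_const.add continuous_id)).sub
          (hF₂c.comp (continuous_const.add continuous_id)))).aestronglyMeasurable
    · refine Eventually.of_forall fun t => Eventually.of_forall fun a => ?_
      rw [norm_mul]
      exact mul_le_mul_of_nonneg_left
        ((norm_sub_le _ _).trans (add_le_add (hF₁b _) (hF₂b _))) (norm_nonneg _)
    · refine Eventually.of_forall fun a => ?_
      refine tendsto_const_nhds.congr' ?_
      filter_upwards [hx a] with t ht
      rw [hF₁F₂ _ ht, sub_self, mul_zero]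
  -- hence the smeared coefficient tends to zero along the path
  have hGlim : Tendsto (fun t => ⟪ψ₁, U (Multiplicative.ofAdd (x t)) v⟫_ℂ) l (𝓝 0) := by
    refine hDC.congr' (Eventually.of_forall fun t => ?_)
    beta_reduce
    rw [hG, show (fun a => (𝓕 g : 𝓢(P, ℂ)) a * (F₁ (x t + a) - F₂ (x t + a))) =
        fun a => (𝓕 g : 𝓢(P, ℂ)) a * F₁ (x t + a) - (𝓕 g : 𝓢(P, ℂ)) a * F₂ (x t + a) from
      funext fun a => mul_sub _ _ _, integral_sub (hI₁ _) (hI₂ _), hG₂, sub_zero]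
  -- conclusion: `‖F₁(x t)‖ ≤ ‖ψ₁‖ ‖χ₁' − v‖ + ‖⟪ψ₁, U(x t) v⟫‖ < δ`
  filter_upwards [Metric.tendsto_nhds.1 hGlim (δ / 2) (by positivity)] with t ht
  rw [dist_zero_right] at ht ⊢
  have hsplit : F₁ (x t) = ⟪ψ₁, U (Multiplicative.ofAdd (x t)) (χ₁' - v)⟫_ℂ +
      ⟪ψ₁, U (Multiplicative.ofAdd (x t)) v⟫_ℂ := by
    simp only [hF₁_def, map_sub, inner_sub_right, sub_add_cancel]
  have h1 : ‖ψ₁‖ * ‖χ₁' - v‖ ≤ δ / 2 := by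
    calc ‖ψ₁‖ * ‖χ₁' - v‖ ≤ ‖ψ₁‖ * (δ / (2 * (‖ψ₁‖ + 1))) :=
          mul_le_mul_of_nonneg_left hgχ.le (norm_nonneg _)
      _ ≤ δ / 2 := by
          rw [mul_div_assoc', div_le_div_iff₀ (by positivity) (by positivity)]
          nlinarith [norm_nonneg ψ₁]
  rw [hsplit]
  calc ‖⟪ψ₁, U (Multiplicative.ofAdd (x t)) (χ₁' - v)⟫_ℂ + ⟪ψ₁, U (Multiplicative.ofAdd (x t)) v⟫_ℂ‖
      ≤ ‖⟪ψ₁, U (Multiplicative.ofAdd (x t)) (χ₁' - v)⟫_ℂ‖ +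
          ‖⟪ψ₁, U (Multiplicative.ofAdd (x t)) v⟫_ℂ‖ := norm_add_le _ _
    _ ≤ ‖ψ₁‖ * ‖χ₁' - v‖ + ‖⟪ψ₁, U (Multiplicative.ofAdd (x t)) v⟫_ℂ‖ := by
        gcongr
        exact U.norm_inner_apply_ofAdd_le _ _ _
    _ < δ / 2 + δ / 2 := add_lt_add_of_le_of_lt h1 ht
    _ = δ := by ring

end UnitaryRep

end Literature.Analysis.UnboundedOperators
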